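import Summits.ValiantsHypothesis.ValiantsHypothesis.Theorems.SymPencilHomogeneousDropRankCodim
import Mathlib.LinearAlgebra.Matrix.ToLinearEquiv
import Mathlib.LinearAlgebra.FiniteDimensional.Lemmas

/-!
# Route `SymPencil` — the split quadratic `6`-space `(k^{2×3}, q_A)` of the cross cell
# (tool file for the size-`27` cell `(10,6,6)` of `sdc(per_4)`, `--supports`
# stmt-ValiantsHypothesis-5674 `SdcSuperquadratic`; rung currency only, nothing here bears on
# `VP ≠ VNP`)

Elementary linear algebra over a field `k`, on `R = k^{2×3}` (the block «rows `1,2` × columns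
`1,2,3`» of a `4 × 4` matrix) with the quadratic form `q_A(r) = r₁ᵀ A r₂` and its polar form
`β_A(r,s) = r₁ᵀ A s₂ + s₁ᵀ A r₂` (`A` a `3 × 3` matrix; symmetric invertible where stated).  This
is the shape of the cubic `per [a; ·] = x₃₀ · q_{A(a')}(x₁', x₂')` on the space `{x₃' = 0}` met by
the affine lever of the cross space `V× = row 0 ⊕ k E₁₀ ⊕ k E₂₀` (`SymPencilAffineKernelLever`),
with `A(a') = [[0,a₃,a₂],[a₃,0,a₁],[a₂,a₁,0]]`.  Contents: the line expansion `q(r + t s)`, the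
polar identities, NON-DEGENERACY of `β_A` (`eq_zero_of_β_eq_zero`), a vector with `q ≠ 0`,
coefficient extraction for cubics in `t`, «linear × `q` ≡ 0 ⇒ linear = 0»
(`linear_eq_zero_of_mul_q`), the polar form as a Mathlib bilinear form, and the bound
**`dim S ≤ 3` for every `q_A`-isotropic subspace `S`** (`finrank_le_three_of_isotropic`, via
`LinearMap.BilinForm.finrank_orthogonal`).  The parity lemma and the cross endgame are in
`SymPencilPerFourCrossSixEndgame`.  No definitions (the forms are passed as functions with their
defining equations), no named facts. [folklore]
-/

noncomputable section

-- single-conjunct layout: Sub = Summit, duplicated namespace component intended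
set_option linter.dupNamespace false

namespace Summit.ValiantsHypothesis.ValiantsHypothesis.Theorems.SymPencilPerFourCrossSixQuadratic

open Matrix Module
open Summit.ValiantsHypothesis.ValiantsHypothesis.Theorems.SymPencilHomogeneousDropRankCodim

universe u

variable {k : Type u} [Field k]

/-! ### The split quadratic space `R = k^{2×3}`, `q_A(r) = r₁ᵀ A r₂` -/

section Quadratic

variable (A : Matrix (Fin 3) (Fin 3) k)
  (q : (Fin 2 × Fin 3 → k) → k) (β : (Fin 2 × Fin 3 → k) → (Fin 2 × Fin 3 → k) → k)

/-- Expansion of `q_A` along a line: `q(r + t s) = q(r) + t β(r,s) + t² q(s)`. [folklore] -/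
theorem q_add_smul (hq : ∀ r : Fin 2 × Fin 3 → k, q r = ∑ i, ∑ j, r (0, i) * A i j * r (1, j)) (hβ : ∀ r s : Fin 2 × Fin 3 → k,
      β r s = ∑ i, ∑ j, (r (0, i) * A i j * s (1, j) + s (0, i) * A i j * r (1, j))) (r s : Fin 2 × Fin 3 → k) (t : k) :
    q (r + t • s) = q r + t * β r s + t ^ 2 * q s := by
  rw [hq, hq, hq, hβ, Finset.mul_sum, Finset.mul_sum, ← Finset.sum_add_distrib,
    ← Finset.sum_add_distrib]
  refine Finset.sum_congr rfl fun i _ => ?_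
  rw [Finset.mul_sum, Finset.mul_sum, ← Finset.sum_add_distrib, ← Finset.sum_add_distrib]
  refine Finset.sum_congr rfl fun j _ => ?_
  simp only [Pi.add_apply, Pi.smul_apply, smul_eq_mul]
  ring

/-- `β` is the polarisation of `q`: `β(r,s) = q(r+s) - q(r) - q(s)`. [folklore] -/
theorem β_eq (hq : ∀ r : Fin 2 × Fin 3 → k, q r = ∑ i, ∑ j, r (0, i) * A i j * r (1, j)) (hβ : ∀ r s : Fin 2 × Fin 3 → k,
      β r s = ∑ i, ∑ j, (r (0, i) * A i j * s (1, j) + s (0, i) * A i j * r (1, j))) (r s : Fin 2 × Fin 3 → k) : β r s = q (r + s) - q r - q s := by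
  have h := q_add_smul A q β hq hβ r s 1
  rw [one_smul, one_mul, one_pow, one_mul] at h
  linear_combination -h

/-- `β` is symmetric. [folklore] -/
theorem β_comm (hq : ∀ r : Fin 2 × Fin 3 → k, q r = ∑ i, ∑ j, r (0, i) * A i j * r (1, j))
    (hβ : ∀ r s : Fin 2 × Fin 3 → k,
      β r s = ∑ i, ∑ j, (r (0, i) * A i j * s (1, j) + s (0, i) * A i j * r (1, j)))
    (r s : Fin 2 × Fin 3 → k) : β r s = β s r := by
  rw [β_eq A q β hq hβ, β_eq A q β hq hβ, add_comm]
  ring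

/-- `β(r,r) = 2 q(r)`. [folklore] -/
theorem β_self (hq : ∀ r : Fin 2 × Fin 3 → k, q r = ∑ i, ∑ j, r (0, i) * A i j * r (1, j))
    (hβ : ∀ r s : Fin 2 × Fin 3 → k,
      β r s = ∑ i, ∑ j, (r (0, i) * A i j * s (1, j) + s (0, i) * A i j * r (1, j)))
    (r : Fin 2 × Fin 3 → k) : β r r = 2 * q r := by
  have h := q_add_smul A q β hq hβ r r 1
  rw [one_smul, one_mul, one_pow, one_mul, ← two_smul k r] at h
  have h2 : q ((2 : k) • r) = 2 ^ 2 * q r := by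
    rw [hq, hq, Finset.mul_sum]
    refine Finset.sum_congr rfl fun i _ => ?_
    rw [Finset.mul_sum]
    refine Finset.sum_congr rfl fun j _ => ?_
    simp only [Pi.smul_apply, smul_eq_mul]; ring
  rw [h2] at h
  linear_combination -h

/-- `β` is additive and homogeneous in the second slot. [folklore] -/
theorem β_add_smul_right (hβ : ∀ r s : Fin 2 × Fin 3 → k,
      β r s = ∑ i, ∑ j, (r (0, i) * A i j * s (1, j) + s (0, i) * A i j * r (1, j))) (r s s' : Fin 2 × Fin 3 → k) (c : k) :
    β r (s + c • s') = β r s + c * β r s' := by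
  rw [hβ, hβ, hβ, Finset.mul_sum, ← Finset.sum_add_distrib]
  refine Finset.sum_congr rfl fun i _ => ?_
  rw [Finset.mul_sum, ← Finset.sum_add_distrib]
  refine Finset.sum_congr rfl fun j _ => ?_
  simp only [Pi.add_apply, Pi.smul_apply, smul_eq_mul]
  ring

/-- `β(·, Y ·)` along a linear map in the second slot is linear in the first slot too:
`β(r + c r', s) = β(r,s) + c β(r', s)`. [folklore] -/
theorem β_add_smul_left (hq : ∀ r : Fin 2 × Fin 3 → k, q r = ∑ i, ∑ j, r (0, i) * A i j * r (1, j)) (hβ : ∀ r s : Fin 2 × Fin 3 → k,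
      β r s = ∑ i, ∑ j, (r (0, i) * A i j * s (1, j) + s (0, i) * A i j * r (1, j))) (r r' s : Fin 2 × Fin 3 → k) (c : k) :
    β (r + c • r') s = β r s + c * β r' s := by
  rw [β_comm A q β hq hβ, β_add_smul_right A β hβ, β_comm A q β hq hβ s r,
    β_comm A q β hq hβ s r']

/-- **Non-degeneracy**: if `A` is symmetric invertible and `β(r, s) = 0` for all `r`, then `s = 0`.
[folklore] -/
theorem eq_zero_of_β_eq_zero (hAs : Aᵀ = A) (hA : IsUnit A.det)
    (hβ : ∀ r s : Fin 2 × Fin 3 → k,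
      β r s = ∑ i, ∑ j, (r (0, i) * A i j * s (1, j) + s (0, i) * A i j * r (1, j)))
    (s : Fin 2 × Fin 3 → k) (h : ∀ r, β r s = 0) : s = 0 := by
  have hinj : Function.Injective A.mulVec :=
    Matrix.mulVec_injective_iff_isUnit.2 ((Matrix.isUnit_iff_isUnit_det A).2 hA)
  -- the second row block of `s` vanishes: test against `r = E_{0,i}`
  have h1 : (fun j => s (1, j)) = 0 := by
    apply hinj
    rw [Matrix.mulVec_zero]
    funext i
    have hi := h (fun p => if p = (0, i) then 1 else 0)
    rw [hβ] at hi
    fin_cases i <;>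
      simpa [Matrix.mulVec, dotProduct, Fin.sum_univ_three] using hi
  -- the first row block vanishes: test against `r = E_{1,j}`
  have h0 : (fun i => s (0, i)) = 0 := by
    have hT : Aᵀ *ᵥ (fun i => s (0, i)) = 0 := by
      funext j
      have hj := h (fun p => if p = (1, j) then 1 else 0)
      rw [hβ] at hj
      fin_cases j <;>
        simpa [Matrix.mulVec, dotProduct, Fin.sum_univ_three, Matrix.transpose_apply,
          mul_comm] using hj
    rw [hAs] at hT
    exact hinj (by rw [hT, Matrix.mulVec_zero])
  funext p
  obtain ⟨a, i⟩ := p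
  fin_cases a
  · exact congr_fun h0 i
  · exact congr_fun h1 i

/-- There is a vector with `q ≠ 0` (an entry `A i j ≠ 0` exists since `A` is invertible).
[folklore] -/
theorem exists_q_ne_zero (hA : IsUnit A.det) (hq : ∀ r : Fin 2 × Fin 3 → k, q r = ∑ i, ∑ j, r (0, i) * A i j * r (1, j)) : ∃ r, q r ≠ 0 := by
  have hA0 : A ≠ 0 := by
    rintro rfl
    rw [Matrix.det_zero] at hA
    exact not_isUnit_zero hA
  obtain ⟨i, j, hij⟩ : ∃ i j, A i j ≠ 0 := by
    by_contra h
    push Not at h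
    exact hA0 (Matrix.ext fun i j => h i j)
  refine ⟨fun p => if p = (0, i) then 1 else if p = (1, j) then 1 else 0, ?_⟩
  rw [hq]
  rw [Finset.sum_eq_single i (fun i' _ hi' => by simp [hi']) (by simp)]
  rw [Finset.sum_eq_single j (fun j' _ hj' => by simp [hj']) (by simp)]
  simpa using hij

/-- Coefficients of a cubic vanishing identically: `c₁ t + c₂ t² + c₃ t³ = 0` for all `t` forces
`c₁ = c₂ = c₃ = 0` (characteristic `0`). [folklore] -/
theorem cubic_coeffs_eq_zero [CharZero k] {c₁ c₂ c₃ : k}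
    (h : ∀ t : k, t * c₁ + t ^ 2 * c₂ + t ^ 3 * c₃ = 0) : c₁ = 0 ∧ c₂ = 0 ∧ c₃ = 0 := by
  have h1 := h 1
  have h2 := h (-1)
  have h3 := h 2
  norm_num at h1 h2 h3
  refine ⟨?_, ?_, ?_⟩
  · linear_combination h1 - (1 / 3 : k) * h2 - (1 / 6 : k) * h3
  · linear_combination (1 / 2 : k) * h1 + (1 / 2 : k) * h2
  · linear_combination (-1 / 2 : k) * h1 - (1 / 6 : k) * h2 + (1 / 6 : k) * h3

/-- **A linear form times the non-zero quadratic form `q_A` is not identically zero**: if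
`φ(r) q(r) = 0` for all `r` then `φ = 0`. [folklore] -/
theorem linear_eq_zero_of_mul_q [CharZero k] (hA : IsUnit A.det) (hq : ∀ r : Fin 2 × Fin 3 → k, q r = ∑ i, ∑ j, r (0, i) * A i j * r (1, j)) (hβ : ∀ r s : Fin 2 × Fin 3 → k,
      β r s = ∑ i, ∑ j, (r (0, i) * A i j * s (1, j) + s (0, i) * A i j * r (1, j)))
    (φ : (Fin 2 × Fin 3 → k) →ₗ[k] k) (h : ∀ r, φ r * q r = 0) : φ = 0 := by
  by_contra hφ
  obtain ⟨r₀, hr₀⟩ : ∃ r₀, φ r₀ ≠ 0 := by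
    by_contra h'
    push Not at h'
    exact hφ (LinearMap.ext h')
  obtain ⟨r₁, hr₁⟩ := exists_q_ne_zero A q hA hq
  -- polarise `φ(r) q(r) ≡ 0` along `r₀ + t r'`
  have hpol : ∀ r r', φ r' * q r + φ r * β r r' = 0 ∧ φ r' * β r r' + φ r * q r' = 0 := by
    intro r r'
    have hc := cubic_coeffs_eq_zero (k := k) (c₁ := φ r' * q r + φ r * β r r')
      (c₂ := φ r' * β r r' + φ r * q r') (c₃ := φ r' * q r') fun t => by
        have e := h (r + t • r')
        rw [map_add, map_smul, smul_eq_mul, q_add_smul A q β hq hβ] at e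
        have e0 := h r
        linear_combination e - e0
    exact ⟨hc.1, hc.2.1⟩
  have hq0 : q r₀ = 0 := by
    have := h r₀
    exact (mul_eq_zero.1 this).resolve_left hr₀
  -- from the two polarised identities at `r = r₀`: `q(r') φ(r₀)² = φ(r')² q(r₀) = 0`
  have key : ∀ r', φ r₀ ^ 2 * q r' = 0 := by
    intro r'
    obtain ⟨e1, e2⟩ := hpol r₀ r'
    rw [hq0, mul_zero, zero_add] at e1
    -- `e1 : φ r₀ * β r₀ r' = 0`, so `β r₀ r' = 0`
    have hb : β r₀ r' = 0 := (mul_eq_zero.1 e1).resolve_left hr₀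
    rw [hb, mul_zero, zero_add] at e2
    linear_combination φ r₀ * e2
  have := key r₁
  rcases mul_eq_zero.1 this with h' | h'
  · exact hr₀ (pow_eq_zero_iff two_ne_zero |>.1 h')
  · exact hr₁ h'


/-- The polar form as a Mathlib bilinear form (existence; avoids a definition). [folklore] -/
theorem exists_bilinForm
    (hq : ∀ r : Fin 2 × Fin 3 → k, q r = ∑ i, ∑ j, r (0, i) * A i j * r (1, j))
    (hβ : ∀ r s : Fin 2 × Fin 3 → k,
      β r s = ∑ i, ∑ j, (r (0, i) * A i j * s (1, j) + s (0, i) * A i j * r (1, j))) :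
    ∃ B : LinearMap.BilinForm k (Fin 2 × Fin 3 → k), ∀ r s, B r s = β r s := by
  have h0 : ∀ s, β 0 s = 0 := fun s => by simp [hβ]
  have h0' : ∀ r, β r 0 = 0 := fun r => by simp [hβ]
  refine ⟨LinearMap.mk₂ k β (fun r r' s => ?_) (fun c r s => ?_) (fun r s s' => ?_)
    (fun c r s => ?_), fun r s => rfl⟩
  · have h := β_add_smul_left A q β hq hβ r r' s 1
    rwa [one_smul, one_mul] at h
  · have h := β_add_smul_left A q β hq hβ 0 r s c
    rwa [zero_add, h0, zero_add] at h
  · have h := β_add_smul_right A β hβ r s s' 1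
    rwa [one_smul, one_mul] at h
  · have h := β_add_smul_right A β hβ r 0 s c
    rwa [zero_add, h0', zero_add] at h

end Quadratic

/-! ### Isotropic subspaces and the parity lemma -/

section Parity

variable [CharZero k] (A : Matrix (Fin 3) (Fin 3) k)
  (q : (Fin 2 × Fin 3 → k) → k) (β : (Fin 2 × Fin 3 → k) → (Fin 2 × Fin 3 → k) → k)

omit [CharZero k] in
/-- **Isotropic subspaces of `q_A` have dimension `≤ 3`** (`A` symmetric invertible).
[folklore] -/
theorem finrank_le_three_of_isotropic (hAs : Aᵀ = A) (hA : IsUnit A.det)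
    (hq : ∀ r : Fin 2 × Fin 3 → k, q r = ∑ i, ∑ j, r (0, i) * A i j * r (1, j))
    (hβ : ∀ r s : Fin 2 × Fin 3 → k,
      β r s = ∑ i, ∑ j, (r (0, i) * A i j * s (1, j) + s (0, i) * A i j * r (1, j)))
    (S : Submodule k (Fin 2 × Fin 3 → k)) (hS : ∀ r ∈ S, q r = 0) : finrank k S ≤ 3 := by
  obtain ⟨B, hB⟩ := exists_bilinForm A q β hq hβ
  have hnd : B.Nondegenerate := by
    refine ⟨fun x hx => ?_, fun y hy => ?_⟩
    · refine eq_zero_of_β_eq_zero A β hAs hA hβ x fun r => ?_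
      rw [β_comm A q β hq hβ, ← hB]; exact hx r
    · exact eq_zero_of_β_eq_zero A β hAs hA hβ y fun r => by rw [← hB]; exact hy r
  have hle : S ≤ B.orthogonal S := by
    intro r hr
    rw [LinearMap.BilinForm.mem_orthogonal_iff]
    intro n hn
    show B n r = 0
    rw [hB, β_eq A q β hq hβ, hS _ (S.add_mem hn hr), hS n hn, hS r hr]
    simp
  have h1 := LinearMap.BilinForm.finrank_orthogonal hnd S
  have h2 := Submodule.finrank_mono hle
  have h6 : finrank k (Fin 2 × Fin 3 → k) = 6 := by
    simp [Module.finrank_fintype_fun_eq_card]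
  have h3 := Submodule.finrank_le S
  rw [h6] at h1 h3
  omega

end Parity

end Summit.ValiantsHypothesis.ValiantsHypothesis.Theorems.SymPencilPerFourCrossSixQuadratic

end
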